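import Summits.KontsevichZagierPeriods.KontsevichZagierPeriods.Theorems.LinRedNormalFormArrangementNormalFormSeparateSplit

/-!
# Stub `stub_rebaseSimplePos` (crux `ArrangementNormalForm`, line `janus-bands`, v6) — part `Tools`

Dictionary for the rebase of separated Janus band representations over a base of dimension
`B + 1` (`x' ∈ ℝ^B` silent, `y` distinguished) with `K` fibres, on the LITERAL class text
`GG B σ K` of the skeleton: the literal integrand `RebasePos.glit` and its semialgebraicity,
semialgebraicity of the literal domain `SeparatePos.gDom`, and the data of the per-fibre affine
pull-back `tᵢ = μᵢ sᵢ + αᵢ y + δᵢ(x')` (rule 2): the maps `Ψ = RebasePos.pullInv`,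
`Φ = RebasePos.pullFwd`, the transformed affine forms `RebasePos.pullC`, bounds `pullLo/pullHi`,
letters `pullA`, the constant `pullQ`, the linear part `pullLin` (matrix `[[1,0],[C, diag μ]]`,
determinant `∏ μᵢ`) and the KEY IDENTITY `tᵢ − c(x', y) = μᵢ (sᵢ − (pullC c)(x', y))`
(`rebaseSimplePos_pullKey`, registered). Part `Pull` proves the move, part `Product` the
product-fibre sub-case of the stub, parts `Cells`/`Janus` the dissection tools.

References: M. Kontsevich, D. Zagier, *Periods* (2001), §1.2, rule (2).
-/

noncomputable section

open Set MeasureTheory MvPolynomial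
open Literature.NumberTheory.Transcendental Literature.ModelTheory.ExponentialFields

namespace Summit.KontsevichZagierPeriods.ArrangementNormalForm.JanusBands

namespace RebasePos

open SeparatePos

section Literal

variable (B K : ℕ)

/-- The literal integrand text of the skeleton class `GG B σ K`:
`p(x')/∏ Lⱼ(x')^{eⱼ} · (y − ℓ₁(x'))^{n₁}/(y − ℓ₂(x'))^{n₂} · ∏ᵢ [1 | 1/(tᵢ − cᵢ(x', y))]`. -/
def glit {m : ℕ} (p : MvPolynomial (Fin B) ℚ) (L : Fin m → (Fin B → ℚ) × ℚ) (e : Fin m → ℕ)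
    (ℓ₁ ℓ₂ : (Fin B → ℚ) × ℚ) (n₁ n₂ : ℕ) (a : Fin K → Option ((Fin (B + 1) → ℚ) × ℚ)) :
    (Fin (B + 1 + K) → ℝ) → ℝ := fun z => MvPolynomial.aeval (fun i => z (Fin.castAdd K (Fin.castSucc i))) p / (∏ j, (∑ i, ((L j).1 i : ℝ) * z (Fin.castAdd K (Fin.castSucc i)) + ((L j).2 : ℝ)) ^ e j) * ((z (Fin.castAdd K (Fin.last B)) - (∑ i, (ℓ₁.1 i : ℝ) * z (Fin.castAdd K (Fin.castSucc i)) + (ℓ₁.2 : ℝ))) ^ n₁ / (z (Fin.castAdd K (Fin.last B)) - (∑ i, (ℓ₂.1 i : ℝ) * z (Fin.castAdd K (Fin.castSucc i)) + (ℓ₂.2 : ℝ))) ^ n₂) * ∏ i, (a i).elim 1 (fun c => 1 / (z (Fin.natAdd (B + 1) i) - (∑ i', (c.1 i' : ℝ) * z (Fin.castAdd K i') + (c.2 : ℝ))))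

variable {B K}

/-- `glit` in terms of `affB` and `fib`. -/
theorem glit_eq {m : ℕ} (p : MvPolynomial (Fin B) ℚ) (L : Fin m → (Fin B → ℚ) × ℚ) (e : Fin m → ℕ)
    (ℓ₁ ℓ₂ : (Fin B → ℚ) × ℚ) (n₁ n₂ : ℕ) (a : Fin K → Option ((Fin (B + 1) → ℚ) × ℚ))
    (z : Fin (B + 1 + K) → ℝ) :
    glit B K p L e ℓ₁ ℓ₂ n₁ n₂ a z =
      MvPolynomial.aeval (fun i => z (Fin.castAdd K (Fin.castSucc i))) p /
        (∏ j, (affB B K (L j) z) ^ e j) *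
        ((z (Fin.castAdd K (Fin.last B)) - affB B K ℓ₁ z) ^ n₁ /
          (z (Fin.castAdd K (Fin.last B)) - affB B K ℓ₂ z) ^ n₂) * fib B K a z := rfl

/-- The literal integrand is a semialgebraic function on every semialgebraic set. -/
theorem isSemialgebraicFunOn_glit {m : ℕ} {σ : Set (Fin (B + 1 + K) → ℝ)} (hσ : IsSemialgebraic ℚ σ)
    (p : MvPolynomial (Fin B) ℚ) (L : Fin m → (Fin B → ℚ) × ℚ) (e : Fin m → ℕ)
    (ℓ₁ ℓ₂ : (Fin B → ℚ) × ℚ) (n₁ n₂ : ℕ) (a : Fin K → Option ((Fin (B + 1) → ℚ) × ℚ)) :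
    IsSemialgebraicFunOn ℚ σ (glit B K p L e ℓ₁ ℓ₂ n₁ n₂ a) := by
  have hq : IsSemialgebraicFunOn ℚ σ (fun z => MvPolynomial.aeval (fun i => z (Fin.castAdd K
      (Fin.castSucc i))) p) :=
    (isSemialgebraicFunOn_aeval hσ (rename (fun i => Fin.castAdd K (Fin.castSucc i)) p)).congr
      fun z _ => by simp [aeval_rename, Function.comp_def]
  have hu : ∀ ℓ : (Fin B → ℚ) × ℚ, IsSemialgebraicFunOn ℚ σ
      (fun z => z (Fin.castAdd K (Fin.last B)) - affB B K ℓ z) := fun ℓ =>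
    (isSemialgebraicFunOn_aeval hσ (X (Fin.castAdd K (Fin.last B)) - affPoly B K ℓ)).congr
      fun z _ => by simp [aeval_affPoly]
  exact IsSemialgebraicFunOn.mul_holds (IsSemialgebraicFunOn.mul_holds
    (IntegrateOut.isSemialgebraicFunOn_div hq (IntegrateOut.isSemialgebraicFunOn_finset_prod _ hσ
      fun j _ => IntegrateOut.isSemialgebraicFunOn_pow (isSemialgebraicFunOn_affB hσ (L j)) _))
    (IntegrateOut.isSemialgebraicFunOn_div (IntegrateOut.isSemialgebraicFunOn_pow (hu ℓ₁) n₁)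
      (IntegrateOut.isSemialgebraicFunOn_pow (hu ℓ₂) n₂))) (isSemialgebraicFunOn_fib hσ a)

/-- The polynomial whose evaluation is the full-base affine form `affF`. -/
def affFPoly (c : (Fin (B + 1) → ℚ) × ℚ) : MvPolynomial (Fin (B + 1 + K)) ℚ :=
  ∑ i, C (c.1 i) * X (Fin.castAdd K i) + C c.2

/-- `affFPoly` evaluates to `affF`. -/
theorem aeval_affFPoly (c : (Fin (B + 1) → ℚ) × ℚ) (z : Fin (B + 1 + K) → ℝ) :
    aeval z (affFPoly (K := K) c) = affF B K c z := by
  simp [affFPoly, affF, map_sum]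

/-- The polynomial of a player (a fibre or a full-base affine form). -/
def playerPoly (u : Fin K ⊕ ((Fin (B + 1) → ℚ) × ℚ)) : MvPolynomial (Fin (B + 1 + K)) ℚ :=
  Sum.elim (fun j => X (Fin.natAdd (B + 1) j)) (fun c => affFPoly c) u

/-- `playerPoly` evaluates to the player value of the literal text. -/
theorem aeval_playerPoly (u : Fin K ⊕ ((Fin (B + 1) → ℚ) × ℚ)) (z : Fin (B + 1 + K) → ℝ) :
    aeval z (playerPoly u) = Sum.elim (fun j => z (Fin.natAdd (B + 1) j))
      (fun c => ∑ i', (c.1 i' : ℝ) * z (Fin.castAdd K i') + (c.2 : ℝ)) u := by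
  rcases u with j | c
  · simp [playerPoly]
  · simp [playerPoly, aeval_affFPoly, affF]

/-- The literal domain `gDom` is semialgebraic. -/
theorem isSemialgebraic_gDom (m' : ℕ) (M : Fin m' → (Fin (B + 1) → ℚ) × ℚ)
    (lo hi : Fin K → Fin K ⊕ ((Fin (B + 1) → ℚ) × ℚ)) :
    IsSemialgebraic ℚ (gDom B K m' M lo hi) := by
  have h1 : IsSemialgebraic ℚ (⋂ j ∈ (Finset.univ : Finset (Fin m')),
      {z : Fin (B + 1 + K) → ℝ | 0 < affF B K (M j) z}) :=
    IsSemialgebraic.biInter _ _ fun j _ => by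
      have : {z : Fin (B + 1 + K) → ℝ | 0 < affF B K (M j) z} =
          {z | 0 < aeval z (affFPoly (K := K) (M j))} := by
        ext z; rw [mem_setOf_eq, mem_setOf_eq, aeval_affFPoly]
      rw [this]
      exact isSemialgebraic_setOf_eval_pos _
  have h2 : IsSemialgebraic ℚ (⋂ i ∈ (Finset.univ : Finset (Fin K)),
      ({z : Fin (B + 1 + K) → ℝ | aeval z (playerPoly (lo i)) < z (Fin.natAdd (B + 1) i)} ∩
       {z : Fin (B + 1 + K) → ℝ | z (Fin.natAdd (B + 1) i) < aeval z (playerPoly (hi i))})) :=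
    IsSemialgebraic.biInter _ _ fun i _ => by
      refine IsSemialgebraic.inter ?_ ?_
      · have : {z : Fin (B + 1 + K) → ℝ | aeval z (playerPoly (lo i)) < z (Fin.natAdd (B + 1) i)} =
            {z | 0 < aeval z (X (Fin.natAdd (B + 1) i) - playerPoly (lo i))} := by
          ext z; simp [sub_pos]
        rw [this]
        exact isSemialgebraic_setOf_eval_pos _
      · have : {z : Fin (B + 1 + K) → ℝ | z (Fin.natAdd (B + 1) i) < aeval z (playerPoly (hi i))} =
            {z | 0 < aeval z (playerPoly (hi i) - X (Fin.natAdd (B + 1) i))} := by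
          ext z; simp [sub_pos]
        rw [this]
        exact isSemialgebraic_setOf_eval_pos _
  convert h1.inter h2 using 1
  ext z
  simp only [gDom, mem_setOf_eq, mem_inter_iff, mem_iInter, Finset.mem_univ, true_imp_iff,
    aeval_playerPoly, affF]

/-- The player value of the literal text. -/
def pv (u : Fin K ⊕ ((Fin (B + 1) → ℚ) × ℚ)) (w : Fin (B + 1 + K) → ℝ) : ℝ :=
  Sum.elim (fun j => w (Fin.natAdd (B + 1) j)) (fun c => ∑ i', (c.1 i' : ℝ) * w (Fin.castAdd K i') +
    (c.2 : ℝ)) u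

end Literal

section PullData

variable {B K : ℕ}

/-- The pulled-back affine form: `c(x', y) ↦ (c − α y − δ(x'))/μ`. -/
def pullC (μ α : ℚ) (δ : (Fin B → ℚ) × ℚ) (c : (Fin (B + 1) → ℚ) × ℚ) : (Fin (B + 1) → ℚ) × ℚ :=
  (fun j => (c.1 j - (Fin.snoc δ.1 α : Fin (B + 1) → ℚ) j) / μ, (c.2 - δ.2) / μ)

/-- The pulled-back lower bounds (swapped with the upper ones where `μᵢ < 0`). -/
def pullLo (μ α : Fin K → ℚ) (δ : Fin K → (Fin B → ℚ) × ℚ)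
    (lo hi : Fin K → Fin K ⊕ ((Fin (B + 1) → ℚ) × ℚ)) (i : Fin K) :
    Fin K ⊕ ((Fin (B + 1) → ℚ) × ℚ) :=
  (if 0 < μ i then lo i else hi i).map id (pullC (μ i) (α i) (δ i))

/-- The pulled-back upper bounds (swapped with the lower ones where `μᵢ < 0`). -/
def pullHi (μ α : Fin K → ℚ) (δ : Fin K → (Fin B → ℚ) × ℚ)
    (lo hi : Fin K → Fin K ⊕ ((Fin (B + 1) → ℚ) × ℚ)) (i : Fin K) :
    Fin K ⊕ ((Fin (B + 1) → ℚ) × ℚ) :=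
  (if 0 < μ i then hi i else lo i).map id (pullC (μ i) (α i) (δ i))

/-- The pulled-back letters. -/
def pullA (μ α : Fin K → ℚ) (δ : Fin K → (Fin B → ℚ) × ℚ)
    (a : Fin K → Option ((Fin (B + 1) → ℚ) × ℚ)) (i : Fin K) : Option ((Fin (B + 1) → ℚ) × ℚ) :=
  (a i).map (pullC (μ i) (α i) (δ i))

/-- The rational constant `∏ᵢ |μᵢ| · ∏_{lettered i} μᵢ⁻¹` absorbed into the numerator. -/
def pullQ (μ : Fin K → ℚ) (a : Fin K → Option ((Fin (B + 1) → ℚ) × ℚ)) : ℚ :=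
  ∏ i, |μ i| * (a i).elim 1 (fun _ => (μ i)⁻¹)

/-- The substitution `Ψ`: `tᵢ = μᵢ sᵢ + αᵢ y + δᵢ(x')`, base coordinates unchanged. -/
def pullInv (μ α : Fin K → ℚ) (δ : Fin K → (Fin B → ℚ) × ℚ) (w : Fin (B + 1 + K) → ℝ) :
    Fin (B + 1 + K) → ℝ :=
  Fin.append (fun j : Fin (B + 1) => w (Fin.castAdd K j))
    (fun i : Fin K => (μ i : ℝ) * w (Fin.natAdd (B + 1) i) +
      (α i : ℝ) * w (Fin.castAdd K (Fin.last B)) + affB B K (δ i) w)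

/-- The inverse substitution `Φ = Ψ⁻¹`: `sᵢ = (tᵢ − αᵢ y − δᵢ(x'))/μᵢ`. -/
def pullFwd (μ α : Fin K → ℚ) (δ : Fin K → (Fin B → ℚ) × ℚ) (z : Fin (B + 1 + K) → ℝ) :
    Fin (B + 1 + K) → ℝ :=
  Fin.append (fun j : Fin (B + 1) => z (Fin.castAdd K j))
    (fun i : Fin K => (z (Fin.natAdd (B + 1) i) - (α i : ℝ) * z (Fin.castAdd K (Fin.last B)) -
      affB B K (δ i) z) / (μ i : ℝ))

variable (μ α : Fin K → ℚ) (δ : Fin K → (Fin B → ℚ) × ℚ)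

/-- `Ψ` fixes the base coordinates. -/
@[simp] theorem pullInv_base (w : Fin (B + 1 + K) → ℝ) (j : Fin (B + 1)) :
    pullInv μ α δ w (Fin.castAdd K j) = w (Fin.castAdd K j) := by
  simp [pullInv]

/-- `Ψ` on the fibre coordinates. -/
@[simp] theorem pullInv_fib (w : Fin (B + 1 + K) → ℝ) (i : Fin K) :
    pullInv μ α δ w (Fin.natAdd (B + 1) i) = (μ i : ℝ) * w (Fin.natAdd (B + 1) i) +
      (α i : ℝ) * w (Fin.castAdd K (Fin.last B)) + affB B K (δ i) w := by
  simp [pullInv]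

/-- `Φ` fixes the base coordinates. -/
@[simp] theorem pullFwd_base (z : Fin (B + 1 + K) → ℝ) (j : Fin (B + 1)) :
    pullFwd μ α δ z (Fin.castAdd K j) = z (Fin.castAdd K j) := by
  simp [pullFwd]

/-- `Φ` on the fibre coordinates. -/
@[simp] theorem pullFwd_fib (z : Fin (B + 1 + K) → ℝ) (i : Fin K) :
    pullFwd μ α δ z (Fin.natAdd (B + 1) i) = (z (Fin.natAdd (B + 1) i) -
      (α i : ℝ) * z (Fin.castAdd K (Fin.last B)) - affB B K (δ i) z) / (μ i : ℝ) := by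
  simp [pullFwd]

/-- `x'`-affine forms are unchanged by `Ψ`. -/
@[simp] theorem affB_pullInv (d : (Fin B → ℚ) × ℚ) (w : Fin (B + 1 + K) → ℝ) :
    affB B K d (pullInv μ α δ w) = affB B K d w := by
  simp [affB]

/-- `x'`-affine forms are unchanged by `Φ`. -/
@[simp] theorem affB_pullFwd (d : (Fin B → ℚ) × ℚ) (z : Fin (B + 1 + K) → ℝ) :
    affB B K d (pullFwd μ α δ z) = affB B K d z := by
  simp [affB]

/-- Full-base affine forms are unchanged by `Ψ`. -/
@[simp] theorem affF_pullInv (c : (Fin (B + 1) → ℚ) × ℚ) (w : Fin (B + 1 + K) → ℝ) :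
    affF B K c (pullInv μ α δ w) = affF B K c w := by
  simp [affF]

/-- `Φ ∘ Ψ = id`. -/
theorem pullFwd_pullInv (hμ : ∀ i, μ i ≠ 0) (w : Fin (B + 1 + K) → ℝ) :
    pullFwd μ α δ (pullInv μ α δ w) = w := by
  funext l
  refine Fin.addCases (fun j => ?_) (fun i => ?_) l
  · simp
  · have h : (μ i : ℝ) ≠ 0 := by exact_mod_cast hμ i
    rw [pullFwd_fib, pullInv_fib, affB_pullInv, pullInv_base]
    field_simp
    ring

/-- `Ψ ∘ Φ = id`. -/
theorem pullInv_pullFwd (hμ : ∀ i, μ i ≠ 0) (z : Fin (B + 1 + K) → ℝ) :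
    pullInv μ α δ (pullFwd μ α δ z) = z := by
  funext l
  refine Fin.addCases (fun j => ?_) (fun i => ?_) l
  · simp
  · have h : (μ i : ℝ) ≠ 0 := by exact_mod_cast hμ i
    rw [pullInv_fib, pullFwd_fib, affB_pullFwd, pullFwd_base]
    field_simp
    ring

/-- **The key affine identity**: `tᵢ − c(x', y) = μᵢ (sᵢ − (pullC c)(x', y))` under `Ψ`. -/
theorem pullInv_fib_sub_affF (hμ : ∀ i, μ i ≠ 0) (i : Fin K) (c : (Fin (B + 1) → ℚ) × ℚ) (w : Fin (B + 1 + K) → ℝ) :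
    pullInv μ α δ w (Fin.natAdd (B + 1) i) - affF B K c w =
      (μ i : ℝ) * (w (Fin.natAdd (B + 1) i) - affF B K (pullC (μ i) (α i) (δ i) c) w) := by
  have h : (μ i : ℝ) ≠ 0 := by exact_mod_cast hμ i
  simp only [pullInv_fib, affF, affB, pullC, Fin.sum_univ_castSucc, Fin.snoc_castSucc,
    Fin.snoc_last, Rat.cast_div, Rat.cast_sub, div_mul_eq_mul_div, ← Finset.sum_div]
  rw [mul_sub, mul_add, mul_div_cancel₀ _ h, mul_div_cancel₀ _ h]
  simp only [sub_mul, Finset.sum_sub_distrib]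
  ring

end PullData

section ProductData

variable {B K : ℕ} (a : Fin K → Option ((Fin (B + 1) → ℚ) × ℚ)) (u v : Fin K → (Fin (B + 1) → ℚ) × ℚ)

/-- Shear slope of the product recipe: the letter slope, or the lower bound's slope. -/
def prodα (i : Fin K) : ℚ := (a i).elim ((u i).1 (Fin.last B)) (fun c => c.1 (Fin.last B))

/-- Scaling of the product recipe: the non-zero sheared bound slope (or `1`). -/
def prodμ (i : Fin K) : ℚ :=
  if (u i).1 (Fin.last B) - prodα a u i = 0 then
    (if (v i).1 (Fin.last B) - prodα a u i = 0 then 1 else (v i).1 (Fin.last B) - prodα a u i)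
  else (u i).1 (Fin.last B) - prodα a u i

/-- Shift of the product recipe: the `x'`-part of the sheared sloped bound (or `0`). -/
def prodδ (i : Fin K) : (Fin B → ℚ) × ℚ :=
  if (u i).1 (Fin.last B) - prodα a u i = 0 then
    (if (v i).1 (Fin.last B) - prodα a u i = 0 then 0 else (fun j => (v i).1 (Fin.castSucc j), (v i).2))
  else (fun j => (u i).1 (Fin.castSucc j), (u i).2)

end ProductData

section Linear

variable {B K : ℕ} (μ α : Fin K → ℚ) (δ : Fin K → (Fin B → ℚ) × ℚ)

/-- Coefficient of the base coordinate `j` in `tᵢ = μᵢ sᵢ + αᵢ y + δᵢ(x')`. -/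
def pullCoef (i : Fin K) (j : Fin (B + 1)) : ℚ := (Fin.snoc (δ i).1 (α i) : Fin (B + 1) → ℚ) j

/-- The matrix `[[1, 0], [C, diag μ]]` of the linear part of `Ψ`. -/
def pullMat : Matrix (Fin (B + 1 + K)) (Fin (B + 1 + K)) ℝ :=
  (Matrix.fromBlocks (1 : Matrix (Fin (B + 1)) (Fin (B + 1)) ℝ) 0
    (fun i j => ((pullCoef α δ i j : ℚ) : ℝ)) (Matrix.diagonal fun i => ((μ i : ℚ) : ℝ))).reindex
    finSumFinEquiv finSumFinEquiv

/-- The linear part of `Ψ` in coordinates. -/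
theorem pullMat_mulVec (w : Fin (B + 1 + K) → ℝ) :
    (pullMat μ α δ).mulVec w = Fin.append (fun j => w (Fin.castAdd K j))
      (fun i => (∑ j, (pullCoef α δ i j : ℝ) * w (Fin.castAdd K j)) +
        (μ i : ℝ) * w (Fin.natAdd (B + 1) i)) := by
  ext l
  refine Fin.addCases (fun j => ?_) (fun i => ?_) l
  · simp [pullMat, Matrix.mulVec, dotProduct, Fin.sum_univ_add, Matrix.fromBlocks_apply₁₁,
      Matrix.fromBlocks_apply₁₂, Matrix.one_apply]
  · simp [pullMat, Matrix.mulVec, dotProduct, Fin.sum_univ_add, Matrix.fromBlocks_apply₂₁,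
      Matrix.fromBlocks_apply₂₂, Matrix.diagonal_apply]

/-- The Jacobian determinant of `Ψ` is `∏ μᵢ`. -/
theorem pullMat_det : (pullMat μ α δ).det = ∏ i, (μ i : ℝ) := by
  rw [pullMat, Matrix.det_reindex_self, Matrix.det_fromBlocks_zero₁₂, Matrix.det_one, one_mul,
    Matrix.det_diagonal]

/-- The linear part of `Ψ` as a continuous linear map. -/
def pullLin : (Fin (B + 1 + K) → ℝ) →L[ℝ] (Fin (B + 1 + K) → ℝ) :=
  LinearMap.toContinuousLinearMap (Matrix.toLin' (pullMat μ α δ))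

/-- The linear part of `Ψ` in coordinates. -/
theorem pullLin_apply (w : Fin (B + 1 + K) → ℝ) :
    pullLin μ α δ w = Fin.append (fun j => w (Fin.castAdd K j))
      (fun i => (∑ j, (pullCoef α δ i j : ℝ) * w (Fin.castAdd K j)) +
        (μ i : ℝ) * w (Fin.natAdd (B + 1) i)) := by
  rw [pullLin, LinearMap.coe_toContinuousLinearMap', Matrix.toLin'_apply, pullMat_mulVec]

/-- The determinant of the linear part of `Ψ`. -/
theorem pullLin_det : (pullLin μ α δ).det = ∏ i, (μ i : ℝ) := by
  rw [pullLin, ContinuousLinearMap.det, LinearMap.coe_toContinuousLinearMap, LinearMap.det_toLin',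
    pullMat_det]

/-- The constant part of `Ψ`. -/
def pullVec : Fin (B + 1 + K) → ℝ :=
  Fin.append (fun _ : Fin (B + 1) => (0 : ℝ)) (fun i => (((δ i).2 : ℚ) : ℝ))

/-- `Ψ` is the affine map `pullLin + pullVec`. -/
theorem pullInv_eq (w : Fin (B + 1 + K) → ℝ) : pullInv μ α δ w = pullLin μ α δ w + pullVec δ := by
  funext l
  refine Fin.addCases (fun j => ?_) (fun i => ?_) l
  · simp [pullLin_apply, pullVec]
  · simp only [pullInv_fib, affB, pullLin_apply, pullVec, Pi.add_apply, Fin.append_right, pullCoef,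
      Fin.sum_univ_castSucc, Fin.snoc_castSucc, Fin.snoc_last]
    ring

/-- `Ψ` has derivative `pullLin` everywhere. -/
theorem hasFDerivAt_pullInv (w : Fin (B + 1 + K) → ℝ) :
    HasFDerivAt (pullInv μ α δ) (pullLin μ α δ) w := by
  have h : pullInv μ α δ = fun w => pullLin μ α δ w + pullVec δ := funext (pullInv_eq μ α δ)
  rw [h]
  exact (pullLin μ α δ).hasFDerivAt.add_const _

/-- `Ψ` as a polynomial map. -/
def pullPoly : Fin (B + 1 + K) → MvPolynomial (Fin (B + 1 + K)) ℚ :=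
  Fin.append (fun j => X (Fin.castAdd K j))
    (fun i => C (μ i) * X (Fin.natAdd (B + 1) i) + C (α i) * X (Fin.castAdd K (Fin.last B)) +
      affPoly B K (δ i))

/-- `pullPoly` evaluates to `Ψ`. -/
theorem aeval_pullPoly (w : Fin (B + 1 + K) → ℝ) :
    (fun l => aeval w (pullPoly μ α δ l)) = pullInv μ α δ w := by
  funext l
  refine Fin.addCases (fun j => ?_) (fun i => ?_) l
  · simp [pullPoly]
  · simp [pullPoly, aeval_affPoly]

/-- `Ψ` is injective. -/
theorem pullInv_injective (hμ : ∀ i, μ i ≠ 0) : Function.Injective (pullInv μ α δ) :=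
  fun w w' h => by
    rw [← pullFwd_pullInv μ α δ hμ w, ← pullFwd_pullInv μ α δ hμ w', h]

/-- `Φ` is continuous. -/
theorem continuous_pullFwd : Continuous (pullFwd μ α δ) := by
  refine continuous_pi fun l => ?_
  refine Fin.addCases (fun j => ?_) (fun i => ?_) l
  · simp only [pullFwd_base]
    fun_prop
  · simp only [pullFwd_fib, affB]
    fun_prop

end Linear

end RebasePos

/-- Registered support goal of this file (the key identity of the pull-back): under
`tᵢ = μᵢ sᵢ + αᵢ y + δᵢ(x')`, `tᵢ − c(x', y) = μᵢ (sᵢ − (pullC c)(x', y))`. -/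
theorem rebaseSimplePos_pullKey (B K : ℕ) (μ α : Fin K → ℚ) (δ : Fin K → (Fin B → ℚ) × ℚ) (hμ : ∀ i, μ i ≠ 0) (i : Fin K) (c : (Fin (B + 1) → ℚ) × ℚ) (w : Fin (B + 1 + K) → ℝ) : RebasePos.pullInv μ α δ w (Fin.natAdd (B + 1) i) - SeparatePos.affF B K c w = (μ i : ℝ) * (w (Fin.natAdd (B + 1) i) - SeparatePos.affF B K (RebasePos.pullC (μ i) (α i) (δ i) c) w) :=
  RebasePos.pullInv_fib_sub_affF μ α δ hμ i c w

end Summit.KontsevichZagierPeriods.ArrangementNormalForm.JanusBands
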